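import Summits.FinalStateConjecture.FinalStateConjecture.Theorems.SwallowTheDatumKerrShieldedSettlesStubKerrLeafSojournAux1
import Summits.FinalStateConjecture.FinalStateConjecture.Theorems.SwallowTheDatumKerrShieldedSettlesStubCollarCauchy
import Literature.Geometry.Lorentzian.OpensChartGeodesicODE
import Literature.Geometry.Lorentzian.GeodesicSpeed
import Literature.Geometry.Lorentzian.CausalFutureProofs
import Literature.Geometry.Lorentzian.OpensCausality
import HarnessLib

/-!
# `KerrShieldedSettles`, line `tapered-temporal-collar` — stub S4 `stub_kerrLeafSojourn`, part 2:
# null geodesics of the ingoing Kerr–Schild chart: Killing energy, future-directedness, heredity of `J⁺`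

Support file for crux `stmt-FinalStateConjecture-10054`
(`Summit.FinalStateConjecture.FinalStateConjecture.Theses.SwallowTheDatum.KerrShieldedSettles`), stub
`stub_kerrLeafSojourn`.  Curve-level facts about a geodesic `γ` of `Kerr.smoothMetric M a r₁` on an open
parameter interval `s`, read in the single chart `Kerr.region a r₁ ⊆ E4` (`OpensChartGeodesicODE`):

* `ray_hasDerivAt`: the coordinate curve has derivative the velocity, which is itself differentiable;
* `ray_energy_eq`: **conservation of the Killing energy** `E = −g(γ̇, ∂_{t*})` — the momentum form of the
  geodesic equations (`OpensChart.hasDerivAt_momentum_of_isGeodesicOn`) with `∂_{t*} g = 0`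
  (`Kerr.fderiv_bilin_basisVector_zero`);
* `ray_null_eq`: `g(γ̇, γ̇)` is constant (`val_velocity_eq_of_isGeodesicOn_holds`);
* `ray_apply_zero_pos`: a null geodesic which is future-directed (`γ̇⁰ > 0`) at one parameter with
  nonzero energy is future-directed at every parameter (a nonzero null vector has `w⁰ ≠ 0`; continuity
  and connectedness of `s`);
* `ray_isFutureCausalCurveOn`: hence it is a future causal curve of the chart on every sub-interval, and
  `mem_causalFuture_of_le`: **`J⁺(S)` is hereditary along it** (`causalFuture_causalFuture_eq`).

References: O'Neill 1983, Ch. 3, Cor. 3.21, Prop. 3.13 and p. 69; Ch. 9, Prop. 9.25–Lemma 9.26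
(Killing fields give geodesic constants of motion); Ch. 14, p. 402; Dafermos–Rodnianski
arXiv:0811.0354, §5.1.
-/

set_option linter.dupNamespace false

noncomputable section

open Set Filter
open scoped Manifold ContDiff Topology
open Literature.Geometry.Lorentzian

namespace Summit.FinalStateConjecture.FinalStateConjecture.Theorems.SwallowTheDatum.KerrShieldedSettles

namespace KerrLeafSojourn


/-! ## Kinematics of chart curves obeying the speed limit `|ẋ⃗| ≤ ṫ*`

Monotone coordinate time and the displacement bound `‖Δx⃗‖ ≤ Δt*` for a coordinate curve `c : ℝ → E4`
with derivative `v` on an interval `s` and `‖(v t)⃗‖ ≤ (v t)⁰` (the integrated light-cone bound;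
O'Neill 1983, Ch. 5, p. 145 and Ch. 14, p. 415).  The Lipschitz bounds under `(v t)⁰ ≤ B` are in part 1
(`time_sub_le_mul`, `norm_sub_le_mul`). -/

section Kinematics

variable {c v : ℝ → E4} {s : Set ℝ}

/-- The time coordinate has derivative `(v t)⁰`. [folklore] -/
theorem hasDerivAt_time_coord (hc : ∀ t ∈ s, HasDerivAt c (v t) t) {t : ℝ} (ht : t ∈ s) :
    HasDerivAt (fun σ ↦ c σ 0) (v t 0) t :=
  ((EuclideanSpace.proj (0 : Fin 4) : E4 →L[ℝ] ℝ).hasFDerivAt.comp_hasDerivAt t (hc t ht))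

/-- **Monotone time**: `t ↦ (c t)⁰` is monotone on `s` (`(v t)⁰ ≥ |(v t)⃗| ≥ 0`). O'Neill 1983,
Ch. 14, p. 415. [cite: ONeillSemiRiemannian1983, Ch. 14, Def. 14.28 (p. 415)] -/
theorem monotoneOn_time_coord (hs : s.OrdConnected) (hc : ∀ t ∈ s, HasDerivAt c (v t) t)
    (hv : ∀ t ∈ s, ‖E4.spatial (v t)‖ ≤ v t 0) : MonotoneOn (fun σ ↦ c σ 0) s := by
  refine monotoneOn_of_deriv_nonneg hs.convex
    (fun t ht ↦ (hasDerivAt_time_coord hc ht).continuousAt.continuousWithinAt)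
    (fun t ht ↦ (hasDerivAt_time_coord hc (interior_subset ht)).differentiableAt.differentiableWithinAt)
    fun t ht ↦ ?_
  rw [(hasDerivAt_time_coord hc (interior_subset ht)).deriv]
  exact (norm_nonneg _).trans (hv t (interior_subset ht))

/-- **Spatial displacement is bounded by elapsed coordinate time**:
`‖(c σ₂)⃗ − (c σ₁)⃗‖ ≤ (c σ₂)⁰ − (c σ₁)⁰` for `σ₁ ≤ σ₂` in `s` (for each unit vector `w`,
`t ↦ (c t)⁰ − ⟨w, (c t)⃗⟩` is nondecreasing). O'Neill 1983, Ch. 14, p. 415.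
[cite: ONeillSemiRiemannian1983, Ch. 14, Def. 14.28 (p. 415)] -/
theorem norm_spatial_sub_le_time_sub (hs : s.OrdConnected) (hc : ∀ t ∈ s, HasDerivAt c (v t) t)
    (hv : ∀ t ∈ s, ‖E4.spatial (v t)‖ ≤ v t 0) {σ₁ σ₂ : ℝ} (h₁ : σ₁ ∈ s) (h₂ : σ₂ ∈ s)
    (h12 : σ₁ ≤ σ₂) : ‖E4.spatial (c σ₂) - E4.spatial (c σ₁)‖ ≤ c σ₂ 0 - c σ₁ 0 := by
  -- adapted from `Minkowski.norm_spatial_sub_le` (MinkowskiCauchy.lean)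
  set d : E3 := E4.spatial (c σ₂) - E4.spatial (c σ₁) with hd
  by_cases hd0 : d = 0
  · rw [hd0, norm_zero, sub_nonneg]
    exact monotoneOn_time_coord hs hc hv h₁ h₂ h12
  set w : E3 := ‖d‖⁻¹ • d with hw
  have hdpos : 0 < ‖d‖ := norm_pos_iff.mpr hd0
  have hw1 : ‖w‖ = 1 := by
    rw [hw, norm_smul, norm_inv, norm_norm, inv_mul_cancel₀ hdpos.ne']
  set φ : ℝ → ℝ := fun σ ↦ c σ 0 - inner ℝ w (E4.spatial (c σ)) with hφ
  have hφ' : ∀ t ∈ s, HasDerivAt φ (v t 0 - inner ℝ w (E4.spatial (v t))) t := by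
    intro t ht
    have h2 : HasDerivAt (fun σ ↦ E4.spatial (c σ)) (E4.spatial (v t)) t :=
      E4.spatial.hasFDerivAt.comp_hasDerivAt t (hc t ht)
    have h3 : HasDerivAt (fun σ ↦ inner ℝ w (E4.spatial (c σ))) (inner ℝ w (E4.spatial (v t))) t := by
      have := ((innerSL ℝ w).hasFDerivAt.comp_hasDerivAt t h2)
      simpa [Function.comp_def] using this
    exact (hasDerivAt_time_coord hc ht).sub h3
  have hmono : MonotoneOn φ s := by
    refine monotoneOn_of_deriv_nonneg hs.convex
      (fun t ht ↦ (hφ' t ht).continuousAt.continuousWithinAt)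
      (fun t ht ↦ (hφ' t (interior_subset ht)).differentiableAt.differentiableWithinAt) ?_
    intro t ht
    rw [(hφ' t (interior_subset ht)).deriv, sub_nonneg]
    calc inner ℝ w (E4.spatial (v t)) ≤ ‖w‖ * ‖E4.spatial (v t)‖ := real_inner_le_norm _ _
      _ = ‖E4.spatial (v t)‖ := by rw [hw1, one_mul]
      _ ≤ v t 0 := hv t (interior_subset ht)
  have hle := hmono h₁ h₂ h12
  simp only [hφ] at hle
  have hinner : inner ℝ w d = ‖d‖ := by
    rw [hw, real_inner_smul_left, real_inner_self_eq_norm_mul_norm, ← mul_assoc,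
      inv_mul_cancel₀ hdpos.ne', one_mul]
  have : inner ℝ w d = inner ℝ w (E4.spatial (c σ₂)) - inner ℝ w (E4.spatial (c σ₁)) := by
    rw [hd, inner_sub_right]
  linarith

end Kinematics

section Ray

variable [Kerr.Facts] {M a r₁ : ℝ} [(Kerr.smoothMetric M a r₁).HasLeviCivita]
  {γ : ℝ → Kerr.region a r₁} {s : Set ℝ}

/-- **The coordinate geodesic equations, first order part**: along a geodesic of the Kerr chart the
coordinate curve `σ ↦ (γ σ : E4)` has a derivative at every parameter of `s` (its chart velocity,
`CollarCauchy.velocity_eq_deriv`), and this derivative is a continuous function of the parameter there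
(O'Neill 1983, Ch. 3, Cor. 3.21, via `OpensChart.hasDerivAt_of_isGeodesicOn`).
[cite: ONeillSemiRiemannian1983, Ch. 3, Cor. 3.21] -/
theorem ray_hasDerivAt (hγ : IsGeodesicOn (Kerr.smoothMetric M a r₁).leviCivita γ s) {t : ℝ}
    (ht : t ∈ s) :
    HasDerivAt (fun σ ↦ (γ σ : E4)) (deriv (fun σ ↦ (γ σ : E4)) t) t ∧
      ContinuousAt (fun t' ↦ deriv (fun σ ↦ (γ σ : E4)) t') t := by
  have h := OpensChart.hasDerivAt_of_isGeodesicOn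
    (g := (Kerr.smoothMetric M a r₁).toPseudoRiemannianMetric) (G := Kerr.bilin M a)
    (fun _ ↦ rfl) (fun y ↦ Kerr.differentiableAt_bilin M a y) hγ ht
  have hfun : (fun t' ↦ (velocity 𝓘(ℝ, E4) γ t' : E4)) = fun t' ↦ deriv (fun σ ↦ (γ σ : E4)) t' :=
    funext fun t' ↦ CollarCauchy.velocity_eq_deriv γ t'
  refine ⟨?_, ?_⟩
  · rw [← CollarCauchy.velocity_eq_deriv γ t]; exact h.1
  · rw [← hfun]; exact h.2.continuousAt

/-- **Conservation of the Killing energy `E = −g(γ̇, ∂_{t*})`** along a geodesic of the Kerr chart on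
an open interval: `ṗ_{∂₀} = ½ (∂₀ g)(γ̇, γ̇) = 0` (momentum form of the geodesic equations, O'Neill 1983,
Ch. 3, Prop. 3.13 with Cor. 3.21; stationarity `∂_{t*} g = 0`, O'Neill 1995, Ch. 2, §2.2; the constant
of motion of the Killing field `∂_{t*}`, O'Neill 1983, Ch. 9, Lemma 9.26).
[cite: ONeillSemiRiemannian1983, Ch. 9, Lemma 9.26] -/
theorem ray_energy_eq (hs : IsOpen s) (hsc : s.OrdConnected)
    (hγ : IsGeodesicOn (Kerr.smoothMetric M a r₁).leviCivita γ s) {t₁ t₂ : ℝ} (h₁ : t₁ ∈ s)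
    (h₂ : t₂ ∈ s) :
    Kerr.bilin M a (γ t₁) (deriv (fun σ ↦ (γ σ : E4)) t₁) (E4.basisVector 0) =
      Kerr.bilin M a (γ t₂) (deriv (fun σ ↦ (γ σ : E4)) t₂) (E4.basisVector 0) := by
  have hd : ∀ t ∈ s, HasDerivAt
      (fun t' ↦ Kerr.bilin M a (γ t') (deriv (fun σ ↦ (γ σ : E4)) t') (E4.basisVector 0)) 0 t := by
    intro t ht
    have h := OpensChart.hasDerivAt_momentum_of_isGeodesicOn
      (g := (Kerr.smoothMetric M a r₁).toPseudoRiemannianMetric) (G := Kerr.bilin M a)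
      (fun _ ↦ rfl) (fun y ↦ Kerr.differentiableAt_bilin M a y)
      (fun y A B ↦ Kerr.bilin_symm M a y A B) hγ ht (E4.basisVector 0)
    rw [Kerr.fderiv_bilin_basisVector_zero M a (Kerr.differentiableAt_bilin M a (γ t))] at h
    simp only [_root_.zero_apply, mul_zero] at h
    simpa only [CollarCauchy.velocity_eq_deriv] using h
  exact hs.is_const_of_deriv_eq_zero hsc.isPreconnected
    (fun t ht ↦ (hd t ht).differentiableAt.differentiableWithinAt)
    (fun t ht ↦ (hd t ht).deriv) h₁ h₂

/-- **`g(γ̇, γ̇)` is constant** along a geodesic of the Kerr chart on an open interval (O'Neill 1983,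
Ch. 3, p. 69; `val_velocity_eq_of_isGeodesicOn_holds`). [cite: ONeillSemiRiemannian1983, Ch. 3, p. 69] -/
theorem ray_null_eq (hs : IsOpen s) (hsc : s.OrdConnected)
    (hγ : IsGeodesicOn (Kerr.smoothMetric M a r₁).leviCivita γ s) {t₁ t₂ : ℝ} (h₁ : t₁ ∈ s)
    (h₂ : t₂ ∈ s) :
    Kerr.bilin M a (γ t₁) (deriv (fun σ ↦ (γ σ : E4)) t₁) (deriv (fun σ ↦ (γ σ : E4)) t₁) =
      Kerr.bilin M a (γ t₂) (deriv (fun σ ↦ (γ σ : E4)) t₂) (deriv (fun σ ↦ (γ σ : E4)) t₂) := by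
  have h : Kerr.bilin M a (γ t₁) (velocity 𝓘(ℝ, E4) γ t₁) (velocity 𝓘(ℝ, E4) γ t₁) =
      Kerr.bilin M a (γ t₂) (velocity 𝓘(ℝ, E4) γ t₂) (velocity 𝓘(ℝ, E4) γ t₂) :=
    (Kerr.smoothMetric M a r₁).toPseudoRiemannianMetric.val_velocity_eq_of_isGeodesicOn_holds
      hs hsc hγ h₁ h₂
  rwa [CollarCauchy.velocity_eq_deriv, CollarCauchy.velocity_eq_deriv] at h

/-- **Future-directedness propagates along a null geodesic.** If a geodesic of the Kerr chart (`M ≥ 0`)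
on an open interval `s` is null and future-directed (`γ̇⁰ > 0`) at `t₀ ∈ s` with nonzero Killing
momentum `g(γ̇, ∂_{t*}) ≠ 0`, then `γ̇⁰ > 0` at every parameter of `s`: by conservation the velocity never
vanishes, a nonzero null vector has `w⁰ ≠ 0` (`|w⃗| ≤ |w⁰|`), and `t ↦ γ̇⁰(t)` is continuous on the
connected `s`. O'Neill 1983, Ch. 5, Lemma 5.29 ff. (timecones). [cite: ONeillSemiRiemannian1983, Ch. 5, p. 145] -/
theorem ray_apply_zero_pos (hM : 0 ≤ M) (hs : IsOpen s) (hsc : s.OrdConnected)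
    (hγ : IsGeodesicOn (Kerr.smoothMetric M a r₁).leviCivita γ s) {t₀ : ℝ} (h0 : t₀ ∈ s)
    (hnull : Kerr.bilin M a (γ t₀) (deriv (fun σ ↦ (γ σ : E4)) t₀) (deriv (fun σ ↦ (γ σ : E4)) t₀) = 0)
    (hpos : 0 < deriv (fun σ ↦ (γ σ : E4)) t₀ 0)
    (hE : Kerr.bilin M a (γ t₀) (deriv (fun σ ↦ (γ σ : E4)) t₀) (E4.basisVector 0) ≠ 0) {t : ℝ}
    (ht : t ∈ s) : 0 < deriv (fun σ ↦ (γ σ : E4)) t 0 := by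
  -- the time component never vanishes on `s`
  have hne : ∀ t ∈ s, deriv (fun σ ↦ (γ σ : E4)) t 0 ≠ 0 := by
    intro t ht h0t
    have hc : Kerr.bilin M a (γ t) (deriv (fun σ ↦ (γ σ : E4)) t) (deriv (fun σ ↦ (γ σ : E4)) t) ≤ 0 := by
      rw [ray_null_eq hs hsc hγ ht h0, hnull]
    have hv : deriv (fun σ ↦ (γ σ : E4)) t = 0 := eq_zero_of_causal_of_apply_zero hM a _ hc h0t
    apply hE
    rw [← ray_energy_eq hs hsc hγ ht h0, hv, map_zero, _root_.zero_apply]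
  -- continuity of the time component on `s`
  have hcont : ContinuousOn (fun t' ↦ deriv (fun σ ↦ (γ σ : E4)) t' 0) s := fun t' ht' ↦
    (((EuclideanSpace.proj (0 : Fin 4) : E4 →L[ℝ] ℝ).continuous.continuousAt).comp
      (ray_hasDerivAt hγ ht').2).continuousWithinAt
  by_contra hle
  push Not at hle
  obtain ⟨c, hc, hc0⟩ := hsc.isPreconnected.intermediate_value ht h0 hcont ⟨hle, hpos.le⟩
  exact hne c hc hc0

/-- **A future-directed null geodesic is a future causal curve of the chart** on every subset of its
parameter interval (velocity null, nonzero, and `g(V, γ̇) = −γ̇⁰ < 0` for `V = Kerr.timeVector`).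
O'Neill 1983, Ch. 14, p. 402. [cite: ONeillSemiRiemannian1983, Ch. 14, p. 402] -/
theorem ray_isFutureCausalCurveOn (hM : 0 ≤ M) (hs : IsOpen s) (hsc : s.OrdConnected)
    (hγ : IsGeodesicOn (Kerr.smoothMetric M a r₁).leviCivita γ s) {t₀ : ℝ} (h0 : t₀ ∈ s)
    (hnull : Kerr.bilin M a (γ t₀) (deriv (fun σ ↦ (γ σ : E4)) t₀) (deriv (fun σ ↦ (γ σ : E4)) t₀) = 0)
    (hpos : 0 < deriv (fun σ ↦ (γ σ : E4)) t₀ 0)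
    (hE : Kerr.bilin M a (γ t₀) (deriv (fun σ ↦ (γ σ : E4)) t₀) (E4.basisVector 0) ≠ 0) {s' : Set ℝ}
    (hs' : s' ⊆ s) :
    (Kerr.smoothMetric M a r₁).IsFutureCausalCurveOn ((Kerr.timeOrientation M a r₁ hM).ofLE le_top)
      γ s' := by
  intro t ht
  have hts := hs' ht
  have hx : 0 < Kerr.radius a (γ t) := Kerr.radius_pos_of_mem_region (γ t).2
  have hv0 := ray_apply_zero_pos hM hs hsc hγ h0 hnull hpos hE hts
  have hd : MDifferentiableAt 𝓘(ℝ, ℝ) 𝓘(ℝ, E4) γ t :=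
    (mdifferentiableAt_subtypeVal_comp_curve_iff (I := 𝓘(ℝ, E4)) (Kerr.region a r₁)).1
      (mdifferentiableAt_iff_differentiableAt.2 (ray_hasDerivAt hγ hts).1.differentiableAt)
  have hnull' : Kerr.bilin M a (γ t) (deriv (fun σ ↦ (γ σ : E4)) t) (deriv (fun σ ↦ (γ σ : E4)) t) = 0 := by
    rw [ray_null_eq hs hsc hγ hts h0, hnull]
  have hne : deriv (fun σ ↦ (γ σ : E4)) t ≠ 0 := fun h ↦ by
    rw [h] at hv0
    simp at hv0
  have hv := CollarCauchy.velocity_eq_deriv γ t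
  refine ⟨hd, ⟨?_, ?_⟩, ?_⟩
  · change Kerr.bilin M a (γ t) (velocity 𝓘(ℝ, E4) γ t) (velocity 𝓘(ℝ, E4) γ t) ≤ 0
    rw [hv, hnull']
  · intro h0'
    exact hne (hv.symm.trans h0')
  · change Kerr.bilin M a (γ t) (Kerr.timeVector M a (γ t)) (velocity 𝓘(ℝ, E4) γ t) < 0
    rw [Kerr.bilin_timeVector hx, hv]
    linarith

omit [(Kerr.smoothMetric M a r₁).HasLeviCivita] in
/-- **`J⁺(S)` is hereditary along future causal curves of the chart**: if `γ` is a future causal curve on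
`[t₁, t₂]` and `γ t₁ ∈ J⁺(S)` then `γ t₂ ∈ J⁺(S)` (`J⁺(J⁺(S)) = J⁺(S)` on the boundaryless chart,
`causalFuture_causalFuture_eq`). O'Neill 1983, Ch. 14, p. 402. [cite: ONeillSemiRiemannian1983, Ch. 14, p. 402] -/
theorem mem_causalFuture_of_le (hM : 0 ≤ M) {t₁ t₂ : ℝ} (h12 : t₁ ≤ t₂)
    (hcurve : (Kerr.smoothMetric M a r₁).IsFutureCausalCurveOn
      ((Kerr.timeOrientation M a r₁ hM).ofLE le_top) γ (Icc t₁ t₂)) {S : Set (Kerr.region a r₁)}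
    (h₁ : γ t₁ ∈ (Kerr.smoothMetric M a r₁).causalFuture ((Kerr.timeOrientation M a r₁ hM).ofLE le_top) S) :
    γ t₂ ∈ (Kerr.smoothMetric M a r₁).causalFuture ((Kerr.timeOrientation M a r₁ hM).ofLE le_top) S := by
  rcases h12.eq_or_lt with h | h
  · rw [← h]; exact h₁
  · have hn : (2 : ℕ∞ω) ≤ (∞ : ℕ∞ω) := WithTop.coe_le_coe.mpr le_top
    rw [← LorentzianMetric.causalFuture_causalFuture_eq hn S]
    exact Or.inr ⟨γ t₁, h₁, γ, t₁, t₂, h, hcurve, rfl, rfl⟩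

end Ray

end KerrLeafSojourn

open KerrLeafSojourn in
/-- **Registered sub-goal `stub_kerrLeafSojournEnergy` (conservation of the Killing energy along Kerr
geodesics).**  Along a geodesic of the ingoing Kerr–Schild chart on an open parameter interval, the
momentum `g(γ̇, ∂_{t*})` of the stationary Killing field and the speed `g(γ̇, γ̇)` are constant (the chart
velocity being `γ̇ = deriv (σ ↦ (γ σ : E4))`) — the first null-geodesic constants of motion of the tree's
Kerr chart.  O'Neill 1983, Ch. 9, Lemma 9.26; Ch. 3, p. 69. [cite: ONeillSemiRiemannian1983, Ch. 9, Lemma 9.26] -/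
theorem stub_kerrLeafSojournEnergy : ∀ [Kerr.Facts] (M a r₁ : ℝ) [(Kerr.smoothMetric M a r₁).HasLeviCivita]
    (γ : ℝ → Kerr.region a r₁) (s : Set ℝ), IsOpen s → s.OrdConnected →
    IsGeodesicOn (Kerr.smoothMetric M a r₁).leviCivita γ s → ∀ t₁ ∈ s, ∀ t₂ ∈ s,
      Kerr.bilin M a (γ t₁) (deriv (fun σ ↦ (γ σ : E4)) t₁) (E4.basisVector 0) =
          Kerr.bilin M a (γ t₂) (deriv (fun σ ↦ (γ σ : E4)) t₂) (E4.basisVector 0) ∧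
        Kerr.bilin M a (γ t₁) (deriv (fun σ ↦ (γ σ : E4)) t₁) (deriv (fun σ ↦ (γ σ : E4)) t₁) =
          Kerr.bilin M a (γ t₂) (deriv (fun σ ↦ (γ σ : E4)) t₂) (deriv (fun σ ↦ (γ σ : E4)) t₂) :=
  fun _ _ _ _ _ _ hs hsc hγ _ h₁ _ h₂ ↦ ⟨ray_energy_eq hs hsc hγ h₁ h₂, ray_null_eq hs hsc hγ h₁ h₂⟩

end Summit.FinalStateConjecture.FinalStateConjecture.Theorems.SwallowTheDatum.KerrShieldedSettles

end
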